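import Summits.ValiantsHypothesis.ValiantsHypothesis.Theorems.DepthWindowLowBiasRound

/-!
# Route `DepthWindow` — the two ALPHABET-FREE engines of the universal slope-2 builder: small-sum segments and trimming

Cone-free helper (decomp-valiant lens 4, g16) supporting the crux item `HomImmHardTwoOne`
(stmt-ValiantsHypothesis-30635).  The lineage g13–g15 proved the universal low-bias conjecture `ULB₂`
(`UniversalLowBiasAt 2` of `DepthWindowNodeBias`) for words with few letter VALUES by exact continued-fraction
arithmetic.  Generation 16 replaces arithmetic by two alphabet-free mechanisms, valid for arbitrary integer (indeed
real) multisets, which are the engines of a universal builder (rounds of two levels: EXTRACT small-sum groups, then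
REFRESH the leftovers with the drift of the extracted sums):

* `exists_balancedSeq` — BALANCED GREEDY SEQUENCES: if a set `U` of positions holds at least `ℓ` positive and at
  least `ℓ` negative letters, all of modulus `≤ v`, there is an injective sequence of `ℓ` positions of `U` all of
  whose prefix sums lie in the window `(-v, v]` (take a negative letter when the prefix is positive, a positive one
  otherwise);
* `exists_close_prefix` — PIGEONHOLE: `ℓ + 1` integers in a window of `2v` consecutive values contain two at
  distance `< 2v/ℓ`;
* `exists_small_segment` — consequently `U` contains a nonempty set `S` of at most `ℓ` letters with
  `ℓ·|Σ_S x| < 2v` and `Σ_S |x| ≤ ℓ v`.  This is the small-sum lemma of LST 2022 (full version, Lemma 9: among `n`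
  positive and `n` negative reals in `[-1,1]` some `≤ √n + 1` of them sum to `≤ 4/√n` in modulus) sharpened from the
  single size `√n` to EVERY size `ℓ ≤ n`, with constant `2`: precision `v/ℓ` for `ℓ` letters is the "golden rate" of
  the mass-aggregation game (`DepthWindowLowBiasRound`), now available without any hypothesis on the letter values;
* `exists_trim` — TRIMMING (granularity): a value `s < -e` can be raised into `[-e, 0)` by adding goods `g_j ∈ [0, e]`
  from a pool one at a time, unless the whole pool is too light (then all of it is used and the value is still
  `< -e`); the amount used never exceeds `|s|`.

References: [LimayeSrinivasanTavenas2022] CCC 2022 (LIPIcs 234:32) §1.2 «Proof of Theorem 5», Lemma 9 and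
Algorithm 1 of the full version ECCC TR22-090 (greedy extraction of small-sum sets; leftovers handled by the
balancing Lemma 21); [BhargavDuttaSaxena2024] ACM ToCT 16(4):23 §5 (two-letter extraction by convergents — the
arithmetic special case of `exists_small_segment`).
-/

-- layout Summits/ValiantsHypothesis/ValiantsHypothesis forces the duplicated namespace component
set_option linter.dupNamespace false

namespace Summit.ValiantsHypothesis.ValiantsHypothesis.Theorems.DepthWindow.TreeBias

open Finset

variable {n : ℕ}

/-! ### Balanced greedy sequences -/

/-- Prefix sums of the word `x` read along a sequence of positions `f`: `Σ_{p<k} x (f p)`. [folklore] -/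
def seqPrefix (x : Fin n → ℤ) (f : ℕ → Fin n) (k : ℕ) : ℤ := ∑ p ∈ range k, x (f p)

/-- The empty prefix. [folklore] -/
theorem seqPrefix_zero (x : Fin n → ℤ) (f : ℕ → Fin n) : seqPrefix x f 0 = 0 := by
  simp [seqPrefix]

/-- One more step. [folklore] -/
theorem seqPrefix_succ (x : Fin n → ℤ) (f : ℕ → Fin n) (k : ℕ) :
    seqPrefix x f (k + 1) = seqPrefix x f k + x (f k) := by
  simp [seqPrefix, sum_range_succ]

/-- Changing the sequence at or beyond position `k` does not change the first `k` prefix sums. [folklore] -/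
theorem seqPrefix_congr (x : Fin n → ℤ) {f f' : ℕ → Fin n} {k : ℕ} (h : ∀ p < k, f' p = f p) :
    seqPrefix x f' k = seqPrefix x f k :=
  sum_congr rfl fun p hp => by rw [h p (mem_range.1 hp)]

/-- **Balanced greedy sequences.**  If `U` holds `≥ ℓ` positive and `≥ ℓ` negative letters of modulus `≤ v`
(`v ≥ 1`), then for every `k ≤ ℓ` there is an injective sequence of `k` positions in `U` all of whose prefix
sums lie in `(-v, v]`. [folklore] -/
theorem exists_balancedSeq (x : Fin n → ℤ) (U : Finset (Fin n)) {v : ℕ} (hv : 1 ≤ v)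
    (hx : ∀ i ∈ U, |x i| ≤ v) {ℓ : ℕ}
    (hpos : ℓ ≤ (U.filter fun i => 0 < x i).card) (hneg : ℓ ≤ (U.filter fun i => x i < 0).card)
    (i₀ : Fin n) :
    ∀ k ≤ ℓ, ∃ f : ℕ → Fin n, (∀ p < k, f p ∈ U) ∧ Set.InjOn f (range k : Set ℕ) ∧
      ∀ k' ≤ k, -(v : ℤ) < seqPrefix x f k' ∧ seqPrefix x f k' ≤ v := by
  intro k
  induction k with
  | zero =>
    intro _
    refine ⟨fun _ => i₀, fun p hp => absurd hp (Nat.not_lt_zero p), ?_, fun k' hk' => ?_⟩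
    · intro p hp; simp at hp
    · obtain rfl : k' = 0 := Nat.le_zero.1 hk'
      rw [seqPrefix_zero]; constructor <;> omega
  | succ k ih =>
    intro hk
    obtain ⟨f, hfU, hinj, hwin⟩ := ih (Nat.le_of_succ_le hk)
    have hklt : k < ℓ := hk
    -- the positions used so far
    set IMG := (range k).image f with hIMG
    have hcardIMG : IMG.card ≤ k := le_trans card_image_le (card_range k).le
    have hPk := hwin k le_rfl
    -- choose the next letter of the sign opposite to the current prefix
    obtain ⟨a, haU, hasgn, haIMG⟩ : ∃ a ∈ U,
        ((0 < seqPrefix x f k → x a < 0) ∧ (seqPrefix x f k ≤ 0 → 0 < x a)) ∧ a ∉ IMG := by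
      by_cases hP : 0 < seqPrefix x f k
      · obtain ⟨a, ha, haI⟩ := exists_mem_notMem_of_card_lt_card
          (lt_of_le_of_lt hcardIMG (lt_of_lt_of_le hklt hneg))
        rw [mem_filter] at ha
        exact ⟨a, ha.1, ⟨fun _ => ha.2, fun h => absurd hP (not_lt.2 h)⟩, haI⟩
      · obtain ⟨a, ha, haI⟩ := exists_mem_notMem_of_card_lt_card
          (lt_of_le_of_lt hcardIMG (lt_of_lt_of_le hklt hpos))
        rw [mem_filter] at ha
        exact ⟨a, ha.1, ⟨fun h => absurd h hP, fun _ => ha.2⟩, haI⟩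
    have hxa : |x a| ≤ v := hx a haU
    rw [abs_le] at hxa
    -- the extended sequence
    let f' : ℕ → Fin n := fun p => if p = k then a else f p
    have hf'k : f' k = a := by simp [f']
    have hf'p : ∀ p, p ≠ k → f' p = f p := fun p hp => by simp [f', hp]
    have hpre : ∀ k' ≤ k, seqPrefix x f' k' = seqPrefix x f k' := fun k' hk' =>
      seqPrefix_congr x fun p hp => hf'p p (by omega)
    refine ⟨f', fun p hp => ?_, ?_, fun k' hk' => ?_⟩
    · -- values in U
      by_cases hpk : p = k
      · rw [hpk, hf'k]; exact haU
      · rw [hf'p p hpk]; exact hfU p (by omega)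
    · -- injectivity on `range (k+1)`
      intro p hp q hq hpq
      simp only [coe_range, Set.mem_Iio] at hp hq
      by_cases hpk : p = k <;> by_cases hqk : q = k
      · rw [hpk, hqk]
      · rw [hpk, hf'k, hf'p q hqk] at hpq
        exact absurd (hpq ▸ mem_image_of_mem f (mem_range.2 (by omega))) haIMG
      · rw [hqk, hf'k, hf'p p hpk] at hpq
        exact absurd (hpq.symm ▸ mem_image_of_mem f (mem_range.2 (by omega))) haIMG
      · rw [hf'p p hpk, hf'p q hqk] at hpq
        exact hinj (by simp; omega) (by simp; omega) hpq
    · -- the window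
      rcases Nat.lt_or_ge k' (k + 1) with hlt | hge
      · rw [hpre k' (Nat.lt_succ_iff.1 hlt)]
        exact hwin k' (Nat.lt_succ_iff.1 hlt)
      · obtain rfl : k' = k + 1 := le_antisymm hk' hge
        rw [seqPrefix_succ, hpre k le_rfl, hf'k]
        by_cases hP : 0 < seqPrefix x f k
        · have := hasgn.1 hP; constructor <;> omega
        · have := hasgn.2 (not_lt.1 hP); constructor <;> omega

/-! ### Pigeonhole on the prefix sums -/

/-- **Pigeonhole.**  `ℓ + 1` integers in the window `(-v, v]` (`ℓ, v ≥ 1`) contain two, at indices `j < t ≤ ℓ`,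
with `ℓ·|P t − P j| < 2v`. [folklore] -/
theorem exists_close_prefix {ℓ v : ℕ} (hℓ : 1 ≤ ℓ) (hv : 1 ≤ v) (P : ℕ → ℤ)
    (hP : ∀ k ≤ ℓ, -(v : ℤ) < P k ∧ P k ≤ v) :
    ∃ j t, j < t ∧ t ≤ ℓ ∧ (ℓ : ℤ) * |P t - P j| < 2 * v := by
  -- bucket width `q = ⌈2v/ℓ⌉`
  set q := (2 * v + ℓ - 1) / ℓ with hq
  have hℓ0 : 0 < ℓ := hℓ
  have hdm := Nat.div_add_mod (2 * v + ℓ - 1) ℓ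
  have hml := Nat.mod_lt (2 * v + ℓ - 1) hℓ0
  rw [← hq] at hdm
  have hqlow : 2 * v ≤ ℓ * q := by omega
  have hqup : ℓ * q ≤ 2 * v + ℓ - 1 := by omega
  have hq0 : 0 < q := by
    rcases Nat.eq_zero_or_pos q with h0 | h0
    · rw [h0, mul_zero] at hqlow; omega
    · exact h0
  -- the bucket of index k
  let b : ℕ → ℕ := fun k => (P k + v - 1).toNat / q
  have hmaps : ∀ k ∈ range (ℓ + 1), b k ∈ range ℓ := by
    intro k hk
    have hk' : k ≤ ℓ := Nat.lt_succ_iff.1 (mem_range.1 hk)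
    have h1 := hP k hk'
    have hnat : (P k + v - 1).toNat ≤ 2 * v - 1 := by
      have : ((P k + v - 1).toNat : ℤ) = P k + v - 1 := Int.toNat_of_nonneg (by omega)
      omega
    rw [mem_range]
    show (P k + v - 1).toNat / q < ℓ
    rw [Nat.div_lt_iff_lt_mul hq0]
    calc (P k + v - 1).toNat ≤ 2 * v - 1 := hnat
      _ < ℓ * q := by omega
  have hcard : (range ℓ).card < (range (ℓ + 1)).card := by simp
  obtain ⟨k₁, hk₁, k₂, hk₂, hne, hbeq⟩ := exists_ne_map_eq_of_card_lt_of_maps_to hcard hmaps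
  have hk₁' : k₁ ≤ ℓ := Nat.lt_succ_iff.1 (mem_range.1 hk₁)
  have hk₂' : k₂ ≤ ℓ := Nat.lt_succ_iff.1 (mem_range.1 hk₂)
  -- same bucket ⇒ distance ≤ q - 1
  have hclose : ∀ {a c : ℕ}, a ≤ ℓ → c ≤ ℓ → b a = b c → (ℓ : ℤ) * |P a - P c| < 2 * v := by
    intro a c ha hc hb
    have ea : ((P a + v - 1).toNat : ℤ) = P a + v - 1 :=
      Int.toNat_of_nonneg (by have := hP a ha; omega)
    have ec : ((P c + v - 1).toNat : ℤ) = P c + v - 1 :=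
      Int.toNat_of_nonneg (by have := hP c hc; omega)
    have la := Nat.div_mul_le_self (P a + v - 1).toNat q
    have ua := Nat.lt_div_mul_add (a := (P a + v - 1).toNat) hq0
    have lc := Nat.div_mul_le_self (P c + v - 1).toNat q
    have uc := Nat.lt_div_mul_add (a := (P c + v - 1).toNat) hq0
    change (P a + v - 1).toNat / q = (P c + v - 1).toNat / q at hb
    rw [hb] at la ua
    -- |ta - tc| ≤ q - 1 as naturals, hence as integers
    have hdiff : |P a - P c| ≤ (q : ℤ) - 1 := by
      rw [abs_le]; constructor <;> omega
    have hℓq : (ℓ : ℤ) * ((q : ℤ) - 1) < 2 * v := by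
      have : ℓ * (q - 1) < 2 * v := by
        rcases q with _ | q
        · omega
        · simp only [Nat.add_sub_cancel]; rw [Nat.mul_succ] at hqup; omega
      have hq1 : 1 ≤ q := hq0
      zify [hq1] at this
      exact this
    calc (ℓ : ℤ) * |P a - P c| ≤ ℓ * ((q : ℤ) - 1) :=
          mul_le_mul_of_nonneg_left hdiff (by positivity)
      _ < 2 * v := hℓq
  rcases lt_or_gt_of_ne hne with hlt | hgt
  · exact ⟨k₁, k₂, hlt, hk₂', hclose hk₂' hk₁' hbeq.symm⟩
  · exact ⟨k₂, k₁, hgt, hk₁', hclose hk₁' hk₂' hbeq⟩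

/-! ### Small-sum segments -/

/-- **Small-sum sets at every size (LST 2022 Lemma 9, sharpened).**  If `U` holds at least `ℓ ≥ 1` positive and
at least `ℓ` negative letters, all of modulus `≤ v`, then some nonempty `S ⊆ U` of at most `ℓ` letters has
`ℓ·|Σ_{S} x| < 2v` and `Σ_{S} |x| ≤ ℓ·v`. [cite: LimayeSrinivasanTavenas2022, Lemma 9] -/
theorem exists_small_segment (x : Fin n → ℤ) (U : Finset (Fin n)) {v ℓ : ℕ} (hℓ : 1 ≤ ℓ)
    (hx : ∀ i ∈ U, |x i| ≤ v)
    (hpos : ℓ ≤ (U.filter fun i => 0 < x i).card) (hneg : ℓ ≤ (U.filter fun i => x i < 0).card) :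
    ∃ S ⊆ U, S.Nonempty ∧ S.card ≤ ℓ ∧ (ℓ : ℤ) * |∑ i ∈ S, x i| < 2 * v ∧
      ∑ i ∈ S, |x i| ≤ (ℓ : ℤ) * v := by
  classical
  -- a positive letter exists, so `v ≥ 1` and `Fin n` is inhabited
  obtain ⟨i₀, hi₀⟩ : (U.filter fun i => 0 < x i).Nonempty := card_pos.1 (lt_of_lt_of_le hℓ hpos)
  have hv : 1 ≤ v := by
    rw [mem_filter] at hi₀
    have h1 := hx i₀ hi₀.1
    rw [abs_le] at h1
    have : (1 : ℤ) ≤ v := le_trans (show (1 : ℤ) ≤ x i₀ from hi₀.2) h1.2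
    exact_mod_cast this
  obtain ⟨f, hfU, hinj, hwin⟩ := exists_balancedSeq x U hv hx hpos hneg i₀ ℓ le_rfl
  obtain ⟨j, t, hjt, htℓ, hclose⟩ := exists_close_prefix hℓ hv (seqPrefix x f) hwin
  have hsub : (Ico j t : Set ℕ) ⊆ (range ℓ : Set ℕ) := by
    intro p hp
    simp only [coe_Ico, Set.mem_Ico] at hp
    simp only [coe_range, Set.mem_Iio]
    omega
  have hinj' : Set.InjOn f (Ico j t : Set ℕ) := hinj.mono hsub
  refine ⟨(Ico j t).image f, fun i hi => ?_, ?_, ?_, ?_, ?_⟩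
  · obtain ⟨p, hp, rfl⟩ := mem_image.1 hi
    exact hfU p (by have := mem_Ico.1 hp; omega)
  · exact (nonempty_Ico.2 hjt).image f
  · calc ((Ico j t).image f).card ≤ (Ico j t).card := card_image_le
      _ = t - j := Nat.card_Ico j t
      _ ≤ ℓ := by omega
  · rw [sum_image hinj']
    have hseg : ∑ p ∈ Ico j t, x (f p) = seqPrefix x f t - seqPrefix x f j :=
      sum_Ico_eq_sub (fun p => x (f p)) hjt.le
    rw [hseg]; exact hclose
  · rw [sum_image hinj']
    calc ∑ p ∈ Ico j t, |x (f p)| ≤ ∑ _p ∈ Ico j t, (v : ℤ) :=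
          sum_le_sum fun p hp => hx (f p) (hfU p (by have := mem_Ico.1 hp; omega))
      _ = (t - j : ℕ) * (v : ℤ) := by rw [sum_const, Nat.card_Ico, nsmul_eq_mul]
      _ ≤ ℓ * v := by
          have : ((t - j : ℕ) : ℤ) ≤ ℓ := by exact_mod_cast (show t - j ≤ ℓ by omega)
          exact mul_le_mul_of_nonneg_right this (by positivity)

/-! ### Trimming -/

/-- **Trimming (granularity).**  From a pool `Pl` of goods `g_j ∈ [0, e]` one can pick `T ⊆ Pl` raising a value
`s < -e` into `[-e, 0)` — or else the whole pool is used and the value is still `< -e`.  In either case at most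
`|s|` is used. [folklore] -/
theorem exists_trim {m : ℕ} (g : Fin m → ℤ) {e : ℤ} (Pl : Finset (Fin m)) (hg0 : ∀ j ∈ Pl, 0 ≤ g j)
    (hge : ∀ j ∈ Pl, g j ≤ e) {s : ℤ} (hs : s < -e) :
    ∃ T ⊆ Pl, (-e ≤ s + ∑ j ∈ T, g j ∧ s + ∑ j ∈ T, g j < 0) ∨ (T = Pl ∧ s + ∑ j ∈ T, g j < -e) := by
  classical
  induction Pl using Finset.induction_on generalizing s with
  | empty => exact ⟨∅, subset_refl _, Or.inr ⟨rfl, by simpa using hs⟩⟩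
  | @insert a Pl' ha ih =>
    by_cases h : -e ≤ s + g a
    · refine ⟨{a}, by simp, Or.inl ?_⟩
      rw [sum_singleton]
      exact ⟨h, by have := hge a (mem_insert_self a Pl'); omega⟩
    · obtain ⟨T', hT', hprop⟩ := ih (fun j hj => hg0 j (mem_insert_of_mem hj))
        (fun j hj => hge j (mem_insert_of_mem hj)) (s := s + g a) (by omega)
      have haT' : a ∉ T' := fun h' => ha (hT' h')
      refine ⟨insert a T', insert_subset_insert a hT', ?_⟩
      rw [sum_insert haT', ← add_assoc]
      rcases hprop with h1 | ⟨h2, h3⟩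
      · exact Or.inl h1
      · exact Or.inr ⟨by rw [h2], h3⟩

/-- The goods used by a trim never exceed `|s|`: if `s + Σ_T g < 0` with nonnegative goods then
`Σ_T g < |s|`. [folklore] -/
theorem trim_used_lt {m : ℕ} (g : Fin m → ℤ) (T : Finset (Fin m)) {s : ℤ}
    (h : s + ∑ j ∈ T, g j < 0) : ∑ j ∈ T, g j < |s| := by
  have := neg_abs_le s
  omega

end Summit.ValiantsHypothesis.ValiantsHypothesis.Theorems.DepthWindow.TreeBias
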